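import Literature.MathematicalPhysics.QuantumFieldTheory.Balaban1983to89.B6BlockParamOneLevel
import Literature.MathematicalPhysics.QuantumFieldTheory.Balaban1983to89.B6Prop22BlockFamily

/-!
# `Balaban1983to89.B6LeafB6OneLevel` — [B6] **the DAG leaf `b6` in parameter form, `DagBinding.B6BlockParam` (Lemma 2.1 with ∃ c₁(α) ∧
# Props. 2.2, 2.3 ∧ Lemma 2.4 ∧ Props. 2.5, 2.6, 2.7 ∧ Cor. 2.8 — the eight statements of [Balaban1984PropagatorsII], verbatim),
# INHABITED ON ONE `B6.BlockData`**: the one-level knit block of `B6BlockParamOneLevel` with the (2.67) functionals of the genuine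
# `G′_K` of `B6Prop22BlockFamily` — all eight conjuncts are theorems of the tree on these model carriers; non-vacuously (the index family is
# inhabited and every member meets `Hyp21_22 ∧ M₁ ≤ M` with `M₁ = 1`)

FRAMING (verbatim cell line):
statement-level skeleton of published theorems with citation tags; proofs where landed; nothing here is a claim about the Yang–Mills mass gap

Sources (cell `lit-balaban`; seat **r03 gen 11** = the B6 fold owner, own lane under the free-target protocol G.5-34(d); SKELETON row **B6.Main**
(decl column `B6.StatedBlock` / `B6.MainResults` / `DagBinding.B6BlockParam`); the two inputs are this seat's `B6BlockParamOneLevel`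
(`b6BlockParam_knit_iff`: the leaf on the knit block ⟺ its Prop. 2.2 conjunct; seven conjuncts by name from r02/r03/p01/b05/b06 files, see
there) and `B6Prop22BlockFamily` (`prop22Printed_block`: the eighth)): T. Bałaban, *Propagators and renormalization transformations for
lattice gauge theories. II*, Commun. Math. Phys. **96** (1984) 223–250 [`Balaban1984PropagatorsII`, "B6"], pp. 223–250: Lemma 2.1 p. 234,
Prop. 2.2 p. 234, Prop. 2.3 p. 238, Lemma 2.4 p. 245, Prop. 2.5 p. 246, Prop. 2.6 p. 247, Prop. 2.7 p. 249, Cor. 2.8 p. 249; PDF held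
`paper:balaban1984-cmp96-propagators-rt-ii` (journal page = PDF page + 222).

## WHAT THIS FILE PROVES (kernel-checked; 0 sorry; theorems only)

* **`b6BlockParam_oneLevel (hd : 2 ≤ d) (hL : Odd L ∧ 1 < L) (ha : 0 < a) (hδ : 0 < δ₀) (hmsq : 0 ≤ msq) :
  DagBinding.B6BlockParam (knitBlock d L a δ₀ (blockGp d L a msq))`** — the leaf, all eight conjuncts.
* `b6BlockRest_oneLevel` — the printed block WITHOUT its Lemma 2.1 conjunct (`DagBinding.B6BlockRest` = Props. 2.2, 2.3 ∧ Lemma 2.4 ∧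
  Props. 2.5, 2.6, 2.7 ∧ Cor. 2.8 AS PRINTED) on the same block; `mainResults_oneLevel'` (the «main technical results» as a corollary, =
  `DagBinding.b6BlockParam_mainResults`).
* **`leaf_b6_inhabited (hd : 2 ≤ d) (hL : Odd L ∧ 1 < L) (ha : 0 < a) :
  ∃ D : B6.BlockData, Nonempty D.I ∧ (∀ i, (D.geo i).Hyp21_22 ∧ 1 ≤ (D.geo i).M) ∧ DagBinding.B6BlockParam D`** — the non-vacuous
  existential form (witness: `δ₀ = 1`, `m² = 0`).

## HONEST SCOPE ∕ NOT CLAIMED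

Exactly the scope of the two inputs: ONE LEVEL (Ω₁ = … = Ω_K = T_η, all sites at scale K, every prefactor `(L^jη)^{…} = 1`, `R = M = 1`,
(2.1)–(2.2) void, d(y, y′) = the ℓ¹ unit-lattice distance), scalar model (U = 1), torus, every dimension `d ≥ 2`, odd `L > 1`, `a > 0`
(the print: a = 1), `m² ≥ 0` (the print: m² = 0), constants OURS (the b05/r02/p01 lineage's, not the print's; the printed c₁(α) of Lemma
2.1 is refuted as typed for d ≥ 3 on multi-level geometries, G-A11-1 — the leaf carries Lemma 2.1 in PARAMETER form, which is what is
proved); supports read with [4]'s doubled cubes; the (2.67) functionals vanish on the 2-tensor source kinds; the site kernels of Props.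
2.3/2.7 are read through the base points of bonds.  The genuinely multi-level leaf (k ≥ 2 distinct levels, the glueings (2.50)/(2.86)/
(2.141), `M` large) remains the DAG HYPOTHESIS `Upstream.b6` of every binder that does not choose these carriers; `B6.StatedBlock` (the
literal c₁(α)) is NOT claimed.  Value = a DAG leaf inhabited, non-vacuously, by one family of model carriers; NOT summit progress.
-/

namespace Literature.MathematicalPhysics.QuantumFieldTheory.Balaban1983to89.B6LeafB6OneLevel

open Literature.MathematicalPhysics.QuantumFieldTheory.Balaban1983to89.B6 (BlockData MainResults)
open B6MainResultsOneLevel (blockGeo)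
open B6BlockParamOneLevel (knitBlock b6BlockParam_knit_iff knit_meets_hypotheses)
open B6Prop22BlockFamily (blockGp prop22Printed_block)
open B5ResidualGpTorusHolds (TopIdx)
open DagBinding (B6BlockParam B6BlockRest b6BlockParam_mainResults)

section Leaf

variable (d L : ℕ) (a : ℝ)

/-- **THE LEAF `b6` ON ONE `BlockData`**: `DagBinding.B6BlockParam` — Lemma 2.1 (∃ c₁(α)) ∧ Prop. 2.2 ∧ Prop. 2.3 ∧ Lemma 2.4 ∧ Prop. 2.5 ∧
Prop. 2.6 ∧ Prop. 2.7 ∧ Cor. 2.8, verbatim — holds for the one-level knit block carrying the (2.67) functionals of the genuine `G′_K`, for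
every `d ≥ 2`, odd `L > 1`, `a > 0`, `δ₀ > 0`, `m² ≥ 0` (`b6BlockParam_knit_iff` ∘ `prop22Printed_block`).
[cite: Balaban1984PropagatorsII, pp.223–250 (Lemma 2.1 p.234, Prop. 2.2 p.234, Prop. 2.3 p.238, Lemma 2.4 p.245, Prop. 2.5 p.246, Prop. 2.6 p.247, Prop. 2.7 p.249, Cor. 2.8 p.249); one level, constants ours] -/
theorem b6BlockParam_oneLevel (hd : 2 ≤ d) (hL : Odd L ∧ 1 < L) (ha : 0 < a) {δ₀ : ℝ} (hδ : 0 < δ₀) {msq : ℝ} (hmsq : 0 ≤ msq) :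
    B6BlockParam (knitBlock d L a δ₀ (blockGp d L a msq)) :=
  (b6BlockParam_knit_iff d L a hd hL ha hδ (blockGp d L a msq)).mpr (prop22Printed_block d L a (le_trans one_le_two hd) hL ha hmsq)

/-- the printed block WITHOUT its Lemma 2.1 conjunct (`DagBinding.B6BlockRest`: Props. 2.2, 2.3 ∧ Lemma 2.4 ∧ Props. 2.5, 2.6, 2.7 ∧ Cor. 2.8,
AS PRINTED) on the same block. [cite: Balaban1984PropagatorsII, pp.223–250] -/
theorem b6BlockRest_oneLevel (hd : 2 ≤ d) (hL : Odd L ∧ 1 < L) (ha : 0 < a) {δ₀ : ℝ} (hδ : 0 < δ₀) {msq : ℝ} (hmsq : 0 ≤ msq) :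
    B6BlockRest (knitBlock d L a δ₀ (blockGp d L a msq)) :=
  (b6BlockParam_oneLevel d L a hd hL ha hδ hmsq).2

/-- the «main technical results» (Prop. 2.6 ∧ Cor. 2.8, p. 249) as a corollary of the leaf, through the DAG's own projection
`DagBinding.b6BlockParam_mainResults`. [cite: Balaban1984PropagatorsII, p.249] -/
theorem mainResults_oneLevel' (hd : 2 ≤ d) (hL : Odd L ∧ 1 < L) (ha : 0 < a) {δ₀ : ℝ} (hδ : 0 < δ₀) {msq : ℝ} (hmsq : 0 ≤ msq) :
    MainResults (knitBlock d L a δ₀ (blockGp d L a msq)) :=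
  b6BlockParam_mainResults _ (b6BlockParam_oneLevel d L a hd hL ha hδ hmsq)

/-- **THE LEAF `b6` IS INHABITED, NON-VACUOUSLY**: for every `d ≥ 2`, odd `L > 1`, `a > 0` there is a `B6.BlockData` whose index family is
inhabited, all of whose members meet the hypotheses `Hyp21_22 ∧ M₁ ≤ M` of the eight statements with `M₁ = 1`, and for which
`DagBinding.B6BlockParam` holds (witness: the knit block with `δ₀ = 1`, `m² = 0`). [cite: Balaban1984PropagatorsII, pp.223–250; one level, constants ours] -/
theorem leaf_b6_inhabited (hd : 2 ≤ d) (hL : Odd L ∧ 1 < L) (ha : 0 < a) :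
    ∃ D : BlockData, Nonempty D.I ∧ (∀ i, (D.geo i).Hyp21_22 ∧ (1 : ℝ) ≤ (D.geo i).M) ∧ B6BlockParam D :=
  ⟨knitBlock d L a 1 (blockGp d L a 0), B6Prop26OneScaleFromB5.topIdx_nonempty (le_trans one_le_two hd) hL,
    fun i => knit_meets_hypotheses d L a 1 (blockGp d L a 0) i, b6BlockParam_oneLevel d L a hd hL ha one_pos le_rfl⟩

end Leaf

end Literature.MathematicalPhysics.QuantumFieldTheory.Balaban1983to89.B6LeafB6OneLevel
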